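import Summits.Parity.GeneralizedHardyLittlewood.Theorems.LeeYangFibresFibrationLemmaMinFactor
import Mathlib.Analysis.SpecialFunctions.Exp
import HarnessLib

/-!
# Fibration lemma (`DimOne → GeneralizedHardyLittlewood`), part 6: the tails of the singular products

Support file for the statement item `FibrationLemma : DimOne → GeneralizedHardyLittlewood`
(Green–Tao 2010, §1, remark after Conj. 1.2). With the minimal fibre factors `m_p` of part 4, the
partial singular products of the fibre systems `Φ_w` and of `Ψ` over the primes of `(z, x]`
(`tailPrimes z x`) factor as

  `∏_{z<p≤x} β_p(Φ_w) = B · R(w)`,   `∏_{z<p≤x} β_p(Ψ) = B · R̄`,   `B = ∏_{z<p≤x} m_p`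

(`tailB`, `tailR`, `tailRbar`; `prod_tailPrimes_fibre_eq`, `prod_tailPrimes_eq`), hence
`∏_{p≤x} β_p(Φ_w) = (∏_{p≤z} β_p(Φ_w)) · B · R(w)` and likewise for `Ψ`
(`singularProductPartial_fibre_split`, `singularProductPartial_split`), valid once `z` exceeds the
threshold `2L² + 2t` (all primes `> z` are large). The ratios are `≥ 1` and close to `1`:

* `one_le_tailR`, `one_le_tailRbar`, `tailB_nonneg`;
* `tailRbar_le_exp` — `R̄ ≤ exp(2t³/z)` (from `β_p(Ψ) ≤ m_p (1 + t³/(p(p-t)))` and `∑_{p>z} p⁻² ≤ 1/z`);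
* `tailR_le_exp_tailX` — `R(w) ≤ exp(X(w))`, `X(w) = ∑_{z<p≤x, w non-generic at p} (t-1)/(p-t)`
  (`tailX`), since `β_p(Φ_w) = m_p` at generic `w` and `≤ m_p (p-1)/(p-t)` always;
* `tailX_eq_of_mem_goodSet` — for a good base point only primes `p ≤ D_max = 2L²(d+1)N` can be
  non-generic, so `X(w)` does not depend on `x ≥ D_max`.
-/

noncomputable section

open Finset

namespace Summit.Parity.GeneralizedHardyLittlewood.Theorems

open Literature.NumberTheory.Sieve

variable {d t : ℕ}

/-! ### The primes of `(z, x]` -/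

/-- The primes `p` with `z < p ≤ x`. [folklore] -/
def tailPrimes (z x : ℕ) : Finset ℕ :=
  (Nat.primesLE x).filter fun p => z < p

/-- Membership in `tailPrimes`. [folklore] -/
theorem mem_tailPrimes {z x p : ℕ} : p ∈ tailPrimes z x ↔ p.Prime ∧ z < p ∧ p ≤ x := by
  unfold tailPrimes
  rw [Finset.mem_filter, Nat.mem_primesLE]
  tauto

/-- `primesLE x = primesLE z ∪ tailPrimes z x` (disjointly) for `z ≤ x`. [folklore] -/
theorem primesLE_eq_union_tailPrimes {z x : ℕ} (hzx : z ≤ x) :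
    Nat.primesLE x = Nat.primesLE z ∪ tailPrimes z x := by
  ext p
  rw [Finset.mem_union, mem_tailPrimes, Nat.mem_primesLE, Nat.mem_primesLE]
  constructor
  · rintro ⟨hpx, hp⟩
    by_cases h : p ≤ z
    · exact Or.inl ⟨h, hp⟩
    · exact Or.inr ⟨hp, by omega, hpx⟩
  · rintro (⟨hpz, hp⟩ | ⟨hp, -, hpx⟩)
    · exact ⟨hpz.trans hzx, hp⟩
    · exact ⟨hpx, hp⟩

/-- The two pieces are disjoint. [folklore] -/
theorem disjoint_primesLE_tailPrimes (z x : ℕ) : Disjoint (Nat.primesLE z) (tailPrimes z x) := by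
  rw [Finset.disjoint_left]
  intro p hp hq
  rw [Nat.mem_primesLE] at hp
  rw [mem_tailPrimes] at hq
  omega

/-- Splitting a product over `p ≤ x` at `z ≤ x`. [folklore] -/
theorem prod_primesLE_split {z x : ℕ} (hzx : z ≤ x) (f : ℕ → ℝ) :
    ∏ p ∈ Nat.primesLE x, f p = (∏ p ∈ Nat.primesLE z, f p) * ∏ p ∈ tailPrimes z x, f p := by
  rw [primesLE_eq_union_tailPrimes hzx, Finset.prod_union (disjoint_primesLE_tailPrimes z x)]

/-- `tailPrimes z x ⊆ Ioc z x`. [folklore] -/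
theorem tailPrimes_subset_Ioc (z x : ℕ) : tailPrimes z x ⊆ Finset.Ioc z x := fun p hp => by
  rw [mem_tailPrimes] at hp
  exact Finset.mem_Ioc.mpr ⟨hp.2.1, hp.2.2⟩

/-- Monotonicity in `x`. [folklore] -/
theorem tailPrimes_mono {z x x' : ℕ} (h : x ≤ x') : tailPrimes z x ⊆ tailPrimes z x' := fun p hp => by
  rw [mem_tailPrimes] at hp ⊢
  exact ⟨hp.1, hp.2.1, hp.2.2.trans h⟩

/-! ### The factorisation of the tails -/

/-- `B = ∏_{z<p≤x} m_p`. [cite: GreenTao2010, §1 (remark after Conj. 1.2)] -/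
def tailB (Ψ : Fin t → AffLinForm (d + 1)) (z x : ℕ) : ℝ :=
  ∏ p ∈ tailPrimes z x, minFactor Ψ p

/-- `R(w) = ∏_{z<p≤x} β_p(Φ_w)/m_p`. [cite: GreenTao2010, §1 (remark after Conj. 1.2)] -/
def tailR (Ψ : Fin t → AffLinForm (d + 1)) (z x : ℕ) (w : Fin d → ℤ) : ℝ :=
  ∏ p ∈ tailPrimes z x, localFactor (fibreSystem Ψ w) p / minFactor Ψ p

/-- `R̄ = ∏_{z<p≤x} β_p(Ψ)/m_p`. [cite: GreenTao2010, §1 (remark after Conj. 1.2)] -/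
def tailRbar (Ψ : Fin t → AffLinForm (d + 1)) (z x : ℕ) : ℝ :=
  ∏ p ∈ tailPrimes z x, localFactor Ψ p / minFactor Ψ p

/-- The threshold beyond which all primes are *large* for `Ψ`: `2L² + 2t`. [folklore] -/
def tailThreshold (t L : ℕ) : ℕ := 2 * L * L + 2 * t

section Threshold

variable {Ψ : Fin t → AffLinForm (d + 1)} {L z : ℕ}

/-- Primes beyond the threshold are large: `2L² < p`, `2t < p` (so `L < p`, `t < p`). [folklore] -/
theorem large_of_mem_tailPrimes (hz : tailThreshold t L ≤ z) {x p : ℕ} (hp : p ∈ tailPrimes z x) :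
    p.Prime ∧ 2 * L * L < p ∧ 2 * t < p := by
  rw [mem_tailPrimes] at hp
  unfold tailThreshold at hz
  exact ⟨hp.1, by omega, by omega⟩

/-- `L < p` for such primes (given `1 ≤ L`). [folklore] -/
theorem lt_of_two_mul_sq_lt {L p : ℕ} (hL : 1 ≤ L) (h : 2 * L * L < p) : L < p :=
  lt_of_le_of_lt (by nlinarith) h

/-- `m_p > 0` for `p` beyond the threshold. [folklore] -/
theorem minFactor_pos_of_mem (hL : ∀ i j, ((Ψ i).coeff j).natAbs ≤ L) (ha : ∀ i, lastCoeff (Ψ i) ≠ 0)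
    (ht : 1 ≤ t) (hz : tailThreshold t L ≤ z) {x p : ℕ} (hp : p ∈ tailPrimes z x) : 0 < minFactor Ψ p := by
  obtain ⟨hprime, hpL, hpt⟩ := large_of_mem_tailPrimes hz hp
  haveI := Fact.mk hprime
  exact minFactor_pos hL ha (lt_of_two_mul_sq_lt (one_le_of_coeff_bound hL ha ht) hpL) (by omega)

/-- `B ≥ 0` (unconditionally: local factors are non-negative). [folklore] -/
theorem tailB_nonneg (Ψ : Fin t → AffLinForm (d + 1)) (z x : ℕ) : 0 ≤ tailB Ψ z x :=
  Finset.prod_nonneg fun _ _ => localFactor_nonneg _ _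

/-- **`∏_{z<p≤x} β_p(Φ_w) = B · R(w)`**. [cite: GreenTao2010, §1 (remark after Conj. 1.2)] -/
theorem prod_tailPrimes_fibre_eq (hL : ∀ i j, ((Ψ i).coeff j).natAbs ≤ L) (ha : ∀ i, lastCoeff (Ψ i) ≠ 0)
    (ht : 1 ≤ t) (hz : tailThreshold t L ≤ z) (x : ℕ) (w : Fin d → ℤ) :
    ∏ p ∈ tailPrimes z x, localFactor (fibreSystem Ψ w) p = tailB Ψ z x * tailR Ψ z x w := by
  unfold tailB tailR
  rw [← Finset.prod_mul_distrib]
  refine Finset.prod_congr rfl fun p hp => ?_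
  rw [mul_div_cancel₀ _ (minFactor_pos_of_mem hL ha ht hz hp).ne']

/-- **`∏_{z<p≤x} β_p(Ψ) = B · R̄`**. [cite: GreenTao2010, §1 (remark after Conj. 1.2)] -/
theorem prod_tailPrimes_eq (hL : ∀ i j, ((Ψ i).coeff j).natAbs ≤ L) (ha : ∀ i, lastCoeff (Ψ i) ≠ 0)
    (ht : 1 ≤ t) (hz : tailThreshold t L ≤ z) (x : ℕ) :
    ∏ p ∈ tailPrimes z x, localFactor Ψ p = tailB Ψ z x * tailRbar Ψ z x := by
  unfold tailB tailRbar
  rw [← Finset.prod_mul_distrib]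
  refine Finset.prod_congr rfl fun p hp => ?_
  rw [mul_div_cancel₀ _ (minFactor_pos_of_mem hL ha ht hz hp).ne']

/-- `∏_{p≤x} β_p(Φ_w) = (∏_{p≤z} β_p(Φ_w)) · B · R(w)` for `z ≤ x`.
[cite: GreenTao2010, §1 (remark after Conj. 1.2)] -/
theorem singularProductPartial_fibre_split (hL : ∀ i j, ((Ψ i).coeff j).natAbs ≤ L)
    (ha : ∀ i, lastCoeff (Ψ i) ≠ 0) (ht : 1 ≤ t) (hz : tailThreshold t L ≤ z) {x : ℕ} (hzx : z ≤ x)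
    (w : Fin d → ℤ) :
    singularProductPartial (fibreSystem Ψ w) x =
      singularProductPartial (fibreSystem Ψ w) z * tailB Ψ z x * tailR Ψ z x w := by
  unfold singularProductPartial
  rw [prod_primesLE_split hzx, prod_tailPrimes_fibre_eq hL ha ht hz x w, mul_assoc]

/-- `∏_{p≤x} β_p(Ψ) = (∏_{p≤z} β_p(Ψ)) · B · R̄` for `z ≤ x`. [cite: GreenTao2010, §1 (remark after Conj. 1.2)] -/
theorem singularProductPartial_split (hL : ∀ i j, ((Ψ i).coeff j).natAbs ≤ L)
    (ha : ∀ i, lastCoeff (Ψ i) ≠ 0) (ht : 1 ≤ t) (hz : tailThreshold t L ≤ z) {x : ℕ} (hzx : z ≤ x) :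
    singularProductPartial Ψ x = singularProductPartial Ψ z * tailB Ψ z x * tailRbar Ψ z x := by
  unfold singularProductPartial
  rw [prod_primesLE_split hzx, prod_tailPrimes_eq hL ha ht hz x, mul_assoc]

/-! ### The ratios are at least `1` -/

/-- A product of reals `≥ 1` is `≥ 1`. [folklore] -/
theorem one_le_prod_of_one_le {ι : Type*} (s : Finset ι) (f : ι → ℝ) (h : ∀ i ∈ s, 1 ≤ f i) :
    1 ≤ ∏ i ∈ s, f i := by
  calc (1 : ℝ) = ∏ _i ∈ s, (1 : ℝ) := Finset.prod_const_one.symm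
    _ ≤ ∏ i ∈ s, f i := Finset.prod_le_prod (fun _ _ => zero_le_one) h

/-- `R(w) ≥ 1`. [folklore] -/
theorem one_le_tailR (hL : ∀ i j, ((Ψ i).coeff j).natAbs ≤ L) (ha : ∀ i, lastCoeff (Ψ i) ≠ 0)
    (ht : 1 ≤ t) (hz : tailThreshold t L ≤ z) (x : ℕ) (w : Fin d → ℤ) : 1 ≤ tailR Ψ z x w := by
  unfold tailR
  refine one_le_prod_of_one_le _ _ fun p hp => ?_
  haveI := Fact.mk (large_of_mem_tailPrimes hz hp).1
  exact (one_le_div (minFactor_pos_of_mem hL ha ht hz hp)).mpr (minFactor_le Ψ w)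

/-- `R̄ ≥ 1`. [folklore] -/
theorem one_le_tailRbar (hL : ∀ i j, ((Ψ i).coeff j).natAbs ≤ L) (ha : ∀ i, lastCoeff (Ψ i) ≠ 0)
    (ht : 1 ≤ t) (hz : tailThreshold t L ≤ z) (x : ℕ) : 1 ≤ tailRbar Ψ z x := by
  unfold tailRbar
  refine one_le_prod_of_one_le _ _ fun p hp => ?_
  haveI := Fact.mk (large_of_mem_tailPrimes hz hp).1
  exact (one_le_div (minFactor_pos_of_mem hL ha ht hz hp)).mpr (minFactor_le_localFactor Ψ)

/-! ### `R̄ ≤ exp(2t³/z)` -/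

/-- A product of reals in `[1, 1 + uₚ]` is at most `exp(∑ uₚ)`. [folklore] -/
theorem prod_le_exp_sum {ι : Type*} (s : Finset ι) (f u : ι → ℝ) (h0 : ∀ i ∈ s, 0 ≤ f i)
    (h : ∀ i ∈ s, f i ≤ 1 + u i) : ∏ i ∈ s, f i ≤ Real.exp (∑ i ∈ s, u i) := by
  rw [Real.exp_sum]
  exact Finset.prod_le_prod h0 fun i hi => (h i hi).trans (by linarith [Real.add_one_le_exp (u i)])

/-- **`R̄ ≤ exp(2 t³ / z)`** for `z` beyond the threshold (and `z ≥ 1`, `d ≥ 1`).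
[cite: GreenTao2010, §1 (remark after Conj. 1.2)] -/
theorem tailRbar_le_exp (hd : 1 ≤ d) (hL : ∀ i j, ((Ψ i).coeff j).natAbs ≤ L)
    (ha : ∀ i, lastCoeff (Ψ i) ≠ 0) (ht : 1 ≤ t) (hz : tailThreshold t L ≤ z) (hz1 : 1 ≤ z) (x : ℕ) :
    tailRbar Ψ z x ≤ Real.exp (2 * (t : ℝ) ^ 3 / z) := by
  unfold tailRbar
  have hbound : ∀ p ∈ tailPrimes z x,
      localFactor Ψ p / minFactor Ψ p ≤ 1 + 2 * (t : ℝ) ^ 3 * ((p : ℝ) ^ 2)⁻¹ := by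
    intro p hp
    obtain ⟨hprime, hpL, hpt⟩ := large_of_mem_tailPrimes hz hp
    haveI := Fact.mk hprime
    have hm := minFactor_pos_of_mem hL ha ht hz hp
    have h1 := localFactor_le_minFactor_mul_add (Ψ := Ψ) hd hL ha hpL (by omega) ht
    rw [div_le_iff₀ hm]
    refine h1.trans ?_
    rw [mul_comm]
    refine mul_le_mul_of_nonneg_right ?_ hm.le
    -- `t³/(p(p-t)) ≤ 2t³/p²` as `p - t ≥ p/2`
    have hp0 : (0 : ℝ) < p := by exact_mod_cast hprime.pos
    have hpt' : (2 * t : ℝ) < p := by exact_mod_cast hpt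
    have hden : (p : ℝ) ^ 2 / 2 ≤ (p : ℝ) * ((p : ℝ) - t) := by nlinarith
    have hpos : (0 : ℝ) < (p : ℝ) ^ 2 / 2 := by positivity
    calc 1 + (t : ℝ) ^ 3 / ((p : ℝ) * ((p : ℝ) - t)) ≤ 1 + (t : ℝ) ^ 3 / ((p : ℝ) ^ 2 / 2) := by
          gcongr
      _ = 1 + 2 * (t : ℝ) ^ 3 * ((p : ℝ) ^ 2)⁻¹ := by ring
  refine (prod_le_exp_sum _ _ _ (fun p hp => div_nonneg (localFactor_nonneg _ _)
    (minFactor_pos_of_mem hL ha ht hz hp).le) hbound).trans ?_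
  rw [Real.exp_le_exp, ← Finset.mul_sum]
  have hsum : ∑ p ∈ tailPrimes z x, ((p : ℝ) ^ 2)⁻¹ ≤ (z : ℝ)⁻¹ :=
    (Finset.sum_le_sum_of_subset_of_nonneg (tailPrimes_subset_Ioc z x) fun _ _ _ => by positivity).trans
      (sum_Ioc_inv_sq_le hz1 x)
  calc 2 * (t : ℝ) ^ 3 * ∑ p ∈ tailPrimes z x, ((p : ℝ) ^ 2)⁻¹ ≤ 2 * (t : ℝ) ^ 3 * (z : ℝ)⁻¹ :=
        mul_le_mul_of_nonneg_left hsum (by positivity)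
    _ = 2 * (t : ℝ) ^ 3 / z := by rw [div_eq_mul_inv]

/-! ### `R(w) ≤ exp(X(w))` -/

open Classical in
/-- `X(w) = ∑_{z<p≤x, w non-generic at p} (t-1)/(p-t)`. [cite: GreenTao2010, §1 (remark after Conj. 1.2)] -/
def tailX (Ψ : Fin t → AffLinForm (d + 1)) (z x : ℕ) (w : Fin d → ℤ) : ℝ :=
  ∑ p ∈ (tailPrimes z x).filter (fun p => w ∉ genericSet Ψ p), ((t : ℝ) - 1) / ((p : ℝ) - t)

/-- `X(w) ≥ 0`. [folklore] -/
theorem tailX_nonneg (ht : 1 ≤ t) (hz : tailThreshold t L ≤ z) (x : ℕ) (w : Fin d → ℤ) :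
    0 ≤ tailX Ψ z x w := by
  classical
  unfold tailX
  refine Finset.sum_nonneg fun p hp => ?_
  obtain ⟨-, -, hpt⟩ := large_of_mem_tailPrimes hz (Finset.mem_filter.mp hp).1
  have h1 : (1 : ℝ) ≤ t := by exact_mod_cast ht
  have h2 : (2 * t : ℝ) < p := by exact_mod_cast hpt
  exact div_nonneg (by linarith) (by linarith)

/-- **`R(w) ≤ exp(X(w))`**: the factor at `p` is `1` if `w` is generic at `p` and at most
`(p-1)/(p-t) = 1 + (t-1)/(p-t)` otherwise. [cite: GreenTao2010, §1 (remark after Conj. 1.2)] -/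
theorem tailR_le_exp_tailX (hL : ∀ i j, ((Ψ i).coeff j).natAbs ≤ L) (ha : ∀ i, lastCoeff (Ψ i) ≠ 0)
    (ht : 1 ≤ t) (hz : tailThreshold t L ≤ z) (x : ℕ) (w : Fin d → ℤ) :
    tailR Ψ z x w ≤ Real.exp (tailX Ψ z x w) := by
  classical
  unfold tailR tailX
  rw [Finset.sum_filter]
  refine prod_le_exp_sum _ _ _ (fun p hp => div_nonneg (localFactor_nonneg _ _)
    (minFactor_pos_of_mem hL ha ht hz hp).le) fun p hp => ?_
  obtain ⟨hprime, hpL, hpt⟩ := large_of_mem_tailPrimes hz hp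
  haveI := Fact.mk hprime
  have hm := minFactor_pos_of_mem hL ha ht hz hp
  have hpL' : L < p := lt_of_two_mul_sq_lt (one_le_of_coeff_bound hL ha ht) hpL
  split_ifs with hgen
  · -- generic: the factor is exactly `1`
    rw [localFactor_eq_minFactor_of_mem_genericSet hL ha hpL' hgen, div_self hm.ne', add_zero]
  · -- non-generic: `β_p(Φ_w)/m_p ≤ (p-1)/(p-t)`
    rw [div_le_iff₀ hm]
    have h1 := localFactor_le_minFactor_mul hL ha hpL' (by omega) ht w
    have hp1 : (2 * t : ℝ) < p := by exact_mod_cast hpt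
    have ht1 : (1 : ℝ) ≤ t := by exact_mod_cast ht
    have hpt0 : (p : ℝ) - t ≠ 0 := by linarith
    have heq : ((p : ℝ) - 1) / ((p : ℝ) - t) = 1 + ((t : ℝ) - 1) / ((p : ℝ) - t) := by
      field_simp
      ring
    calc localFactor (fibreSystem Ψ w) p ≤ minFactor Ψ p * (((p : ℝ) - 1) / ((p : ℝ) - t)) := h1
      _ = (1 + ((t : ℝ) - 1) / ((p : ℝ) - t)) * minFactor Ψ p := by rw [heq, mul_comm]

/-! ### For good base points only primes `≤ D_max` matter -/

/-- If `w` is non-generic at a prime `p` and all its discriminants are non-zero and bounded by `M`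
in absolute value, then `p ≤ M`. [folklore] -/
theorem le_of_not_mem_genericSet {Ψ : Fin t → AffLinForm (d + 1)} {p : ℕ} {w : Fin d → ℤ}
    (hng : w ∉ genericSet Ψ p) (hD : ∀ i j, i ≠ j → (discForm Ψ i j).eval w ≠ 0) {M : ℕ}
    (hM : ∀ i j, |(discForm Ψ i j).eval w| ≤ M) : p ≤ M := by
  rw [mem_genericSet] at hng
  push Not at hng
  obtain ⟨i, j, hij, -, hdvd⟩ := hng
  have hne := hD i j hij
  have h1 : (p : ℤ) ≤ |(discForm Ψ i j).eval w| := by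
    have := Int.le_of_dvd (abs_pos.mpr hne) ((dvd_abs _ _).mpr hdvd)
    simpa using this
  exact_mod_cast h1.trans (hM i j)

/-- **For a good base point, `X(w)` is insensitive to `x ≥ D_max`**: `X_{z,x}(w) = X_{z,min(x,D_max)}(w)`
when `|Dᵢⱼ(w)| ≤ D_max` for all `i, j`. [folklore] -/
theorem tailX_eq_of_mem_goodSet {Ψ : Fin t → AffLinForm (d + 1)} {N z x Dmax : ℕ} {w : Fin d → ℤ}
    (hw : w ∈ goodSet Ψ N) (hM : ∀ i j, |(discForm Ψ i j).eval w| ≤ Dmax) :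
    tailX Ψ z x w = tailX Ψ z (min x Dmax) w := by
  classical
  unfold tailX
  refine Finset.sum_congr ?_ fun _ _ => rfl
  ext p
  simp only [Finset.mem_filter, mem_tailPrimes]
  constructor
  · rintro ⟨⟨hp, hzp, hpx⟩, hng⟩
    exact ⟨⟨hp, hzp, le_min hpx (le_of_not_mem_genericSet hng (mem_goodSet.mp hw).2 hM)⟩, hng⟩
  · rintro ⟨⟨hp, hzp, hpx⟩, hng⟩
    exact ⟨⟨hp, hzp, hpx.trans (min_le_left _ _)⟩, hng⟩

/-- Monotonicity of `X` in `x`. [folklore] -/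
theorem tailX_mono (ht : 1 ≤ t) (hz : tailThreshold t L ≤ z) {x x' : ℕ} (h : x ≤ x') (w : Fin d → ℤ) :
    tailX Ψ z x w ≤ tailX Ψ z x' w := by
  classical
  unfold tailX
  refine Finset.sum_le_sum_of_subset_of_nonneg (Finset.filter_subset_filter _ (tailPrimes_mono h))
    fun p hp _ => ?_
  obtain ⟨-, -, hpt⟩ := large_of_mem_tailPrimes hz (Finset.mem_filter.mp hp).1
  have h1 : (1 : ℝ) ≤ t := by exact_mod_cast ht
  have h2 : (2 * t : ℝ) < p := by exact_mod_cast hpt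
  exact div_nonneg (by linarith) (by linarith)

end Threshold

end Summit.Parity.GeneralizedHardyLittlewood.Theorems
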